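import Mathlib.LinearAlgebra.Vandermonde
import Mathlib.LinearAlgebra.Matrix.NonsingularInverse
import Summits.MatrixMultiplication.MatrixMultiplication.Theses.AssociativePencil
import Literature.Computability.AlgebraicComplexity.MatrixMultiplicationExponent
import Literature.Computability.AlgebraicComplexity.GroupAlgebraTensor
import Literature.Computability.AlgebraicComplexity.AsymptoticRankZariskiClosedProofs

/-!
# MatrixMultiplication / AssociativePencil — support item `LagrangeNodeBound`

Route `MatrixMultiplication/AssociativePencil`, item `stmt-MatrixMultiplication-7194` (support, rank 9):
the divided-difference / Lagrange bound (Bini's interpolation device, Bürgisser–Clausen–Shokrollahi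
1997, Prop. (15.26), here for EXACT rank). For distinct nodes `t₀, …, t_s ∈ ℂ` and tensor
coefficients `ν₀, …, ν_s`, put `F(t) = ∑ⱼ tʲ νⱼ`. The Vandermonde matrix `V = (tᵢʲ)` of the nodes is
invertible, so every coefficient is a linear combination of the node values,
`νⱼ = ∑ᵢ (V⁻¹)ⱼᵢ • F(tᵢ)`; in particular for the top coefficient `ν_s`, and then
`R(ν_s) ≤ ∑ᵢ R((V⁻¹)ₛᵢ • F(tᵢ)) ≤ ∑ᵢ R(F(tᵢ))` by subadditivity (`tensorRank_sum_le`) and scalar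
invariance (`tensorRank_smul_le`) of the tensor rank.

Design: we never write the explicit Lagrange coefficients `1/∏_{k≠i}(tᵢ − t_k)`; Vandermonde
inversion (`Matrix.det_vandermonde_ne_zero_iff`) is all that is needed.
-/

-- Single-conjunct summit: `Summit.MatrixMultiplication.MatrixMultiplication.…` repeats the name by design (D-0017).
set_option linter.dupNamespace false

namespace Summit.MatrixMultiplication.MatrixMultiplication.Theorems

open scoped BigOperators Matrix
open Literature.Computability.AlgebraicComplexity

/-- **Vandermonde inversion of a polynomial family, entrywise.** If the nodes `node : Fin (s+1) → ℂ`
are pairwise distinct and `F i = ∑ j, node i ^ j • ν j` are the values of the family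
`F(t) = ∑ⱼ tʲ νⱼ` at the nodes, then every coefficient is recovered as
`ν j = ∑ i, (V⁻¹) j i • F i`, `V` the Vandermonde matrix of the nodes (here for families of
functions `α → ℂ`, e.g. coordinate tensors). [folklore] -/
theorem coeff_eq_sum_vandermonde_inv_smul_nodeValue {α : Type*} {s : ℕ}
    (ν : Fin (s + 1) → α → ℂ) (node : Fin (s + 1) → ℂ) (hnode : Function.Injective node)
    (j : Fin (s + 1)) :
    ν j = ∑ i, (Matrix.vandermonde node)⁻¹ j i •
      (fun a => ∑ k : Fin (s + 1), node i ^ (k : ℕ) * ν k a) := by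
  have hdet : IsUnit (Matrix.vandermonde node).det :=
    isUnit_iff_ne_zero.mpr (Matrix.det_vandermonde_ne_zero_iff.mpr hnode)
  funext a
  -- the coefficient vector at the entry `a`
  have h1 : (Matrix.vandermonde node)⁻¹ *ᵥ ((Matrix.vandermonde node) *ᵥ fun k => ν k a) =
      fun k => ν k a := by
    rw [Matrix.mulVec_mulVec, Matrix.nonsing_inv_mul _ hdet, Matrix.one_mulVec]
  have h2 := congrFun h1 j
  rw [← h2]
  simp only [Matrix.mulVec, dotProduct, Matrix.vandermonde_apply, Finset.sum_apply, Pi.smul_apply,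
    smul_eq_mul]

/-- **Lagrange node bound** (route `AssociativePencil`, item `stmt-MatrixMultiplication-7194`):
for distinct nodes `t₀, …, t_s` and tensor coefficients `ν₀, …, ν_s` on `ℂ^{n×n}`,
`R(ν_s) ≤ ∑ᵢ R(F(tᵢ))` where `F(t) = ∑ⱼ tʲ νⱼ` (Bini's interpolation device for exact rank,
Bürgisser–Clausen–Shokrollahi 1997, Prop. (15.26); Bläser 2013, §6). -/
theorem lagrangeNodeBound_proof :
    Summit.MatrixMultiplication.MatrixMultiplication.Theses.AssociativePencil.LagrangeNodeBound := by
  unfold Summit.MatrixMultiplication.MatrixMultiplication.Theses.AssociativePencil.LagrangeNodeBound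
  intro n s ν node hnode
  set F : Fin (s + 1) → (Fin n × Fin n → Fin n × Fin n → Fin n × Fin n → ℂ) :=
    fun i z x y => ∑ j : Fin (s + 1), node i ^ (j : ℕ) * ν j z x y with hF
  have hkey : ν (Fin.last s) = ∑ i, (Matrix.vandermonde node)⁻¹ (Fin.last s) i • F i := by
    funext z x y
    have h := congrFun (coeff_eq_sum_vandermonde_inv_smul_nodeValue
      (fun j (p : (Fin n × Fin n) × (Fin n × Fin n) × (Fin n × Fin n)) => ν j p.1 p.2.1 p.2.2)
      node hnode (Fin.last s)) (z, x, y)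
    simp only [Finset.sum_apply, Pi.smul_apply, smul_eq_mul] at h ⊢
    simpa [hF] using h
  calc tensorRank (ν (Fin.last s))
      = tensorRank (∑ i, (Matrix.vandermonde node)⁻¹ (Fin.last s) i • F i) := by rw [hkey]
    _ ≤ ∑ i, tensorRank ((Matrix.vandermonde node)⁻¹ (Fin.last s) i • F i) :=
        tensorRank_sum_le _ _
    _ ≤ ∑ i, tensorRank (F i) := Finset.sum_le_sum fun i _ => tensorRank_smul_le _ _

end Summit.MatrixMultiplication.MatrixMultiplication.Theorems
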